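import Summits.BirchSwinnertonDyer.Rank1Residual.X11a.SelmerCompanionResidueCertificate
import Literature.NumberTheory.EllipticCurves.SerreOpenImageOrdinaryInertiaProofs
import HarnessLib

/-!
# Route (3e) SELMER COMPANION, XXIV: the booking shapes E and D with the RESIDUE-FIELD certificate
# (class X11a = N7; cell `b2b-bsdres`, unit `b2b-bsdres-x11a`, gen 30)

HONEST FRAMING (run/shared/lean/b2b/bsd-rank1-residual/, verbatim in every file): the goal of the
cell is to DELETE the COMBINATION-SHAPED residual classes of the Birch–Swinnerton-Dyer formula for
ALL analytic-rank `≤ 1` elliptic curves over `ℚ` — "full BSD formula for every rank `≤ 1` curve in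
class `C`" assembled STRICTLY from published theorems — so that the rank-`≤ 1` remainder becomes
exactly the CONSTRUCTION-SHAPED classes, which are TYPED (missing-input `Prop`s), NOT attempted.
This is not "finishing BSD". CLASS-OWNERS.md: research routes; NO CLAIM BEYOND STATED CLASSES.
THEOREMS ONLY; nothing booked; no label moves. CONDITIONAL on the PUBLISHED binders GZK (`hGZK`),
Cassels–Tate (`hCT`), Tate uniformisation (`hU` = A40, `hU2` = A41), Tate's local Euler
characteristic (`hEP`, Milne *ADT* I Thm. 2.8; discharged in the tree, n1011-p04 p300487), and on
the per-pair finite data named.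

## What this file proves

The booking shapes of files XXI (shape E, strict place `p`) and XXII (shape D, strict place a split
level-lowering `ℓ₀ ∤ p` of `E` where `A` is GOOD) with the strictness certificate stated as the
census computes it: **in the finite group of points of the reduction of the minimal model of the
partner `A` at the strict prime `ℓ`, `#Ã(𝔽_ℓ) = p·n` and `n·g̃ ≠ O`** for a rational point
`g ∈ A(ℚ)` — `g̃ = red₀ g` for the tree's reduction map `red₀` on `A(K̄_v)` (pinned down by `hred₀`,
`OrdinaryLocalReductionMapProofs`; Silverman VII.2.1), `#Ã(𝔽_ℓ) = reductionPointCount A ℓ`.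

* `bsdp_of_bsdp_partner_of_residue_certificate_at_p` — SHAPE E: `BSD(A,p) ⟹ BSD(E,p)` for a
  rank-`0` curve `E` MULTIPLICATIVE at `p` with a closed GOOD partner `A` (`A[p] ≅ E[p]`) of analytic
  rank `1`, `p ∤ #Ш_an(A)`, `A[p]` irreducible, six kinds of places elsewhere, budget
  `p·∏_T ≤ p`, and the residue certificate at `p` (file XXIII `hcert_of_residue_certificate` feeds
  file XXI);
* `bsdp_of_bsdp_partner_of_residue_certificate_away` — SHAPE D: the same at a strict place
  `v₀ ∋ ℓ₀`, `ℓ₀ ≠ p`, where `A` is good (described by `hkill`, file XIV), with the residue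
  certificate at `ℓ₀` (file XXIII `not_zsmul_of_residue_certificate` feeds file XXII).

Nothing mathematical about the certificate now lives outside the kernel: the inputs of a booking
are `BSD(A,p)` (ledger), the analytic data of `A` and `E`, C1 (`e`/`θ`), the place data, and the
two integers `#Ã(𝔽_ℓ)`, `n` with the finite check `n·g̃ ≠ O`. Not a class theorem; nothing booked.

References: files XIV, XX–XXIII; [SilvermanAEC2009] VII.2.1, VIII.§2, X.§4; [MazurRubin2004] §2.3;
HOME/b2b-bsdres-x11a/REPORT-g30.md.
-/

set_option autoImplicit false

noncomputable section

open scoped Classical NNReal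

open WeierstrassCurve Literature.NumberTheory.EllipticCurves
  Literature.NumberTheory.GaloisRepresentations Field NumberField IsDedekindDomain
  IsDedekindDomain.HeightOneSpectrum Literature.NumberTheory.EllipticCurves.FormalGroupChart
  Literature.NumberTheory.EllipticCurves.Rank1Residual
  Literature.NumberTheory.EllipticCurves.Rank1Residual.Typed

namespace Summit.BirchSwinnertonDyer.Rank1Residual.X11a.SelmerCompanion

variable (W A : WeierstrassCurve ℚ) [W.IsElliptic] [W.IsGloballyMinimal] [A.IsElliptic]
  [A.IsGloballyMinimal] (p : ℕ) [hp : Fact p.Prime]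

/-- **Shape E with the residue-field certificate — `BSD(A,p) ⟹ BSD(E,p)` at a multiplicative-at-`p`
cell with a good rank-one partner.** As `bsdp_of_bsdp_partner_of_generator_certificate_at_p`
(file XXI), with the certificate `hcert` ('no `p`-th root of `g` in `A(K̄_p)` is rational modulo
the kernel of reduction') REPLACED by the census computation: for the reduction map `red₀` of the
minimal model of `A` at the place `v₀ ∋ p` (the tree's `reducePoint`, transported; `hred₀`) and a
rational point `g ∈ A(ℚ)`, `#Ã(𝔽_p) = reductionPointCount A p = p·n` and `n • red₀ g ≠ 0` — i.e.
`(m/p)·g̃ ≠ O in Ã(𝔽_p)` (file XXIII `hcert_of_residue_certificate`). The integrality of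
`A ⊗ K̄_{v₀}` over `𝒪_w` is supplied here (`baseChange_eq_localIntModel_integer_baseChange`).
Binders GZK, Cassels–Tate, A40/A41, Milne I.2.8; inputs BSD(A,p), C1 (`e`), the place data, the
two integers and the finite check. Not a class theorem; nothing booked.
[cite: Miller2011LMS, §1 and Def. 1.1] [cite: MazurRubin2004, §2.3]
[cite: SilvermanAEC2009, Prop. VII.2.1, VIII.§2, X.§4 diagram (**), Thm X.4.2]
[cite: SilvermanATAEC1994, Ch. V Thm. 3.1, Lemma 5.2, Thm. 5.3, Cor. 5.4, Ex. 5.11]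
[cite: GreenbergLNM1716, §2 p. 70 and Props. 2.2, 2.4] [cite: MilneADT2006, Ch. I §2 Thm. 2.8, Prop. 3.8] -/
theorem bsdp_of_bsdp_partner_of_residue_certificate_at_p
    (hU : Silverman1994_thmV53_tateUniformisation.{0})
    (hU2 : Silverman1994_thmV53_corV54_tateUniformisation.{0})
    (hEP : ∀ v : HeightOneSpectrum (𝓞 ℚ), (p : 𝓞 ℚ) ∈ v.asIdeal →
      localEulerPoincareCharacteristic (v.adicCompletion ℚ))
    (hGZK : rank_eq_analyticRank_of_analyticRank_le_one)
    (hCT : exists_casselsTate_pairing (K := ℚ)) (hp2 : p ≠ 2)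
    (hr : W.analyticRank = 0) (hirr : Irr W p) (hSha : X11a.ShaAnUnit W p)
    (hbsdA : BSDp A p) (hrA : A.analyticRank = 1) (hirrA : Irr A p) (hShaA : X11a.ShaAnUnit A p)
    (e : geomTorsion A (p : ℤ) ≃+ geomTorsion W (p : ℤ))
    (he : ∀ (σ : absoluteGaloisGroup ℚ) (P : geomTorsion A (p : ℤ)), e (σ • P) = σ • e P)
    (S T : Finset (HeightOneSpectrum (𝓞 ℚ))) (hTS : T ⊆ S)
    (hS : ∀ v : HeightOneSpectrum (𝓞 ℚ), v ∉ S →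
      A.HasGoodReductionAt v ∧ W.HasGoodReductionAt v ∧ (p : 𝓞 ℚ) ∉ v.asIdeal)
    {v₀ : HeightOneSpectrum (𝓞 ℚ)} (hpv₀ : (p : 𝓞 ℚ) ∈ v₀.asIdeal) (hv₀S : v₀ ∈ S) (hv₀T : v₀ ∉ T)
    (hmult : W.HasMultiplicativeReductionAtPrime p) (hA₀ : A.HasGoodReductionAtPrime p)
    (hplaces : ∀ v ∈ S, v ∉ T → v ≠ v₀ →
      ((p : 𝓞 ℚ) ∉ v.asIdeal ∧ Nat.card (nsmulAddMonoidHom p :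
          (W.baseChange (v.adicCompletion ℚ)).toAffine.Point →+ _).ker = 1) ∨
      (A.HasSplitMultiplicativeReductionAt v ∧ W.HasSplitMultiplicativeReductionAt v ∧
        Nat.card (nsmulAddMonoidHom p :
          (A.baseChange (v.adicCompletion ℚ)).toAffine.Point →+ _).ker ≤ p) ∨
      (A.HasMultiplicativeReductionAt v ∧ W.HasMultiplicativeReductionAt v ∧
        (∃ r : v.adicCompletion ℚ, algebraMap ℚ (v.adicCompletion ℚ) (-(A.c₄ / A.c₆)) =
          r ^ 2 * algebraMap ℚ (v.adicCompletion ℚ) (-(W.c₄ / W.c₆))) ∧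
        (∀ ζ : v.adicCompletion ℚ, ζ ^ p = 1 → ζ = 1)) ∨
      (∃ (ℓ : ℕ) (_ : Fact ℓ.Prime), ℓ ≠ 2 ∧ (ℓ : 𝓞 ℚ) ∈ v.asIdeal ∧ (p : 𝓞 ℚ) ∉ v.asIdeal ∧
        W.HasMultiplicativeReductionAtPrime ℓ ∧
        (∀ r : v.adicCompletion ℚ, algebraMap ℚ (v.adicCompletion ℚ) (-(W.c₄ / W.c₆)) ≠ r ^ 2) ∧
        A.HasGoodReductionAt v) ∨
      ((p : 𝓞 ℚ) ∈ v.asIdeal ∧ W.HasMultiplicativeReductionAtPrime p ∧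
        (∀ r : v.adicCompletion ℚ, algebraMap ℚ (v.adicCompletion ℚ) (-(W.c₄ / W.c₆)) ≠ r ^ 2) ∧
        A.HasGoodReductionAtPrime p) ∨
      (∃ (ℓ : ℕ) (_ : Fact ℓ.Prime), ℓ ≠ 2 ∧ (ℓ : 𝓞 ℚ) ∈ v.asIdeal ∧ (p : 𝓞 ℚ) ∉ v.asIdeal ∧
        W.HasGoodReductionAt v ∧ A.HasMultiplicativeReductionAtPrime ℓ ∧
        (∀ r : v.adicCompletion ℚ, algebraMap ℚ (v.adicCompletion ℚ) (-(A.c₄ / A.c₆)) ≠ r ^ 2)))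
    {w : Valuation (AlgebraicClosure (v₀.adicCompletion ℚ)) ℝ≥0}
    (hw : ∀ x, (w x : ℝ) =
      spectralNorm (v₀.adicCompletion ℚ) (AlgebraicClosure (v₀.adicCompletion ℚ)) x)
    (red₀ : localPoints A (v₀.adicCompletion ℚ) →+
      (((integralModelInt A).map (algebraMap ℤ ↥w.valuationSubring)).map
        (IsLocalRing.residue ↥w.valuationSubring)).toAffine.Point)
    (hred₀ : ∀ P : localPoints A (v₀.adicCompletion ℚ), red₀ P =
      ((integralModelInt A).map (algebraMap ℤ ↥w.valuationSubring)).reducePoint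
        (Affine.Point.congrEquiv (localIntModel_baseChange A w.valuationSubring).symm P))
    (g : A.toAffine.Point) {n : ℕ} (hn : reductionPointCount A p = p * n)
    (hg : n • red₀ (pointsMap A (v₀.adicCompletion ℚ) (toGeomPoints A g)) ≠ 0)
    (hbudget : p * ∏ v ∈ T, (Nat.card (nsmulAddMonoidHom p :
        (W.baseChange (v.adicCompletion ℚ)).toAffine.Point →+ _).ker *
          Nat.card (v.adicCompletionIntegers ℚ ⧸
            Ideal.span {(p : v.adicCompletionIntegers ℚ)})) ≤ p) :
    BSDp W p := by
  haveI hV : (A.baseChange (AlgebraicClosure (v₀.adicCompletion ℚ))).IsIntegral w.integer :=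
    ⟨⟨(integralModelInt A).map (algebraMap ℤ ↥w.integer),
      A.baseChange_eq_localIntModel_integer_baseChange⟩⟩
  have hΔ : ¬ (p : ℤ) ∣ minimalDiscriminantInt A :=
    A.not_dvd_minimalDiscriminantInt_of_hasGoodReductionAtPrime' p hA₀
  exact bsdp_of_bsdp_partner_of_generator_certificate_at_p A p W hU hU2 hEP hGZK hCT hp2 hr hirr
    hSha hbsdA hrA hirrA hShaA e he S T hTS hS hpv₀ hv₀S hv₀T hmult hA₀ hplaces hw g
    (hcert_of_residue_certificate A hpv₀ hw (A.isUnit_Δ_localIntModel hpv₀ hw hΔ) red₀ hred₀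
      hn hg) hbudget

/-- **Shape D with the residue-field certificate — `BSD(A,p) ⟹ BSD(E,p)` with a strict place
`v₀ ∋ ℓ₀`, `ℓ₀ ≠ p`, where the partner `A` is GOOD.** As
`bsdp_of_bsdp_partner_of_generator_certificate_away` (file XXII: the strict place enters through
`hkill`, supplied by file XIV at a SPLIT multiplicative level-lowering place `ℓ₀ ∤ p`, `p ∤ ℓ₀ − 1`,
of `E` where `A` is good), with the certificate '`g ∉ p·A(ℚ_{v₀})`' REPLACED by the census
computation at `ℓ₀`: for the reduction map `red₀` of the minimal model of `A` at `v₀`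
(`A` good at `ℓ₀`, `hAℓ`) and a rational point `g ∈ A(ℚ)`, `#Ã(𝔽_{ℓ₀}) = reductionPointCount A ℓ₀
= p·n` and `n • red₀ g ≠ 0` — i.e. `(m/p)·g̃ ≠ O in Ã(𝔽_{ℓ₀})` (file XXIII
`not_zsmul_of_residue_certificate`: a `ℚ_{v₀}`-rational `p`-th root of `g` would have reduction
killed by `m`). Binders GZK, Cassels–Tate, A40/A41, Milne I.2.8; inputs BSD(A,p), C1 (`θ`), the
place data, the two integers and the finite check. (The mirror shape — `E` good, `A` SPLIT at
`ℓ₀` — keeps the form of file XXII: its census certificate reads the component group, not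
`Ã(𝔽_{ℓ₀})`.) Not a class theorem; nothing booked.
[cite: Miller2011LMS, §1 and Def. 1.1] [cite: MazurRubin2004, §2.3]
[cite: SilvermanAEC2009, Prop. VII.2.1, VIII.§2, X.§4 diagram (**), Thm X.4.2]
[cite: SilvermanATAEC1994, Ch. V Thm. 3.1, Lemma 5.2, Thm. 5.3, Cor. 5.4, Ex. 5.11]
[cite: GreenbergLNM1716, §2 p. 70 and Props. 2.2, 2.4] [cite: MilneADT2006, Ch. I §2 Thm. 2.8, Prop. 3.8] -/
theorem bsdp_of_bsdp_partner_of_residue_certificate_away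
    (hU : Silverman1994_thmV53_tateUniformisation.{0})
    (hU2 : Silverman1994_thmV53_corV54_tateUniformisation.{0})
    (hEP : ∀ v : HeightOneSpectrum (𝓞 ℚ), (p : 𝓞 ℚ) ∈ v.asIdeal →
      localEulerPoincareCharacteristic (v.adicCompletion ℚ))
    (hGZK : rank_eq_analyticRank_of_analyticRank_le_one)
    (hCT : exists_casselsTate_pairing (K := ℚ)) (hp2 : p ≠ 2)
    (hr : W.analyticRank = 0) (hirr : Irr W p) (hSha : X11a.ShaAnUnit W p)
    (hbsdA : BSDp A p) (hrA : A.analyticRank = 1) (hirrA : Irr A p) (hShaA : X11a.ShaAnUnit A p)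
    (θ : geomTorsion W (p : ℤ) ≃+ geomTorsion A (p : ℤ))
    (hθ : ∀ (σ : absoluteGaloisGroup ℚ) (P : geomTorsion W (p : ℤ)), θ (σ • P) = σ • θ P)
    (S T : Finset (HeightOneSpectrum (𝓞 ℚ))) (hTS : T ⊆ S)
    (hS : ∀ v : HeightOneSpectrum (𝓞 ℚ), v ∉ S →
      A.HasGoodReductionAt v ∧ W.HasGoodReductionAt v ∧ (p : 𝓞 ℚ) ∉ v.asIdeal)
    (hplaces : ∀ v ∈ S, v ∉ T →
      ((p : 𝓞 ℚ) ∉ v.asIdeal ∧ Nat.card (nsmulAddMonoidHom p :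
          (W.baseChange (v.adicCompletion ℚ)).toAffine.Point →+ _).ker = 1) ∨
      (A.HasSplitMultiplicativeReductionAt v ∧ W.HasSplitMultiplicativeReductionAt v ∧
        Nat.card (nsmulAddMonoidHom p :
          (A.baseChange (v.adicCompletion ℚ)).toAffine.Point →+ _).ker ≤ p) ∨
      (A.HasMultiplicativeReductionAt v ∧ W.HasMultiplicativeReductionAt v ∧
        (∃ r : v.adicCompletion ℚ, algebraMap ℚ (v.adicCompletion ℚ) (-(A.c₄ / A.c₆)) =
          r ^ 2 * algebraMap ℚ (v.adicCompletion ℚ) (-(W.c₄ / W.c₆))) ∧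
        (∀ ζ : v.adicCompletion ℚ, ζ ^ p = 1 → ζ = 1)) ∨
      (∃ (ℓ : ℕ) (_ : Fact ℓ.Prime), ℓ ≠ 2 ∧ (ℓ : 𝓞 ℚ) ∈ v.asIdeal ∧ (p : 𝓞 ℚ) ∉ v.asIdeal ∧
        W.HasMultiplicativeReductionAtPrime ℓ ∧
        (∀ r : v.adicCompletion ℚ, algebraMap ℚ (v.adicCompletion ℚ) (-(W.c₄ / W.c₆)) ≠ r ^ 2) ∧
        A.HasGoodReductionAt v) ∨
      ((p : 𝓞 ℚ) ∈ v.asIdeal ∧ W.HasMultiplicativeReductionAtPrime p ∧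
        (∀ r : v.adicCompletion ℚ, algebraMap ℚ (v.adicCompletion ℚ) (-(W.c₄ / W.c₆)) ≠ r ^ 2) ∧
        A.HasGoodReductionAtPrime p) ∨
      (∃ (ℓ : ℕ) (_ : Fact ℓ.Prime), ℓ ≠ 2 ∧ (ℓ : 𝓞 ℚ) ∈ v.asIdeal ∧ (p : 𝓞 ℚ) ∉ v.asIdeal ∧
        W.HasGoodReductionAt v ∧ A.HasMultiplicativeReductionAtPrime ℓ ∧
        (∀ r : v.adicCompletion ℚ, algebraMap ℚ (v.adicCompletion ℚ) (-(A.c₄ / A.c₆)) ≠ r ^ 2)))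
    {v₀ : HeightOneSpectrum (𝓞 ℚ)}
    (hkill : ∀ c ∈ selmerLocalKer W (v₀.adicCompletion ℚ) (p : ℤ),
      h1Equiv θ hθ c ∈ selmerLocalKer A (v₀.adicCompletion ℚ) (p : ℤ) →
      galoisCohomology.res (A.torsionGaloisModule (p : ℤ)) (v₀.adicCompletion ℚ) 1
        (h1Equiv θ hθ c) = 0)
    {ℓ₀ : ℕ} [Fact ℓ₀.Prime] (hℓv₀ : (ℓ₀ : 𝓞 ℚ) ∈ v₀.asIdeal) (hAℓ : A.HasGoodReductionAtPrime ℓ₀)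
    {w : Valuation (AlgebraicClosure (v₀.adicCompletion ℚ)) ℝ≥0}
    (hw : ∀ x, (w x : ℝ) =
      spectralNorm (v₀.adicCompletion ℚ) (AlgebraicClosure (v₀.adicCompletion ℚ)) x)
    (red₀ : localPoints A (v₀.adicCompletion ℚ) →+
      (((integralModelInt A).map (algebraMap ℤ ↥w.valuationSubring)).map
        (IsLocalRing.residue ↥w.valuationSubring)).toAffine.Point)
    (hred₀ : ∀ P : localPoints A (v₀.adicCompletion ℚ), red₀ P =
      ((integralModelInt A).map (algebraMap ℤ ↥w.valuationSubring)).reducePoint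
        (Affine.Point.congrEquiv (localIntModel_baseChange A w.valuationSubring).symm P))
    (g : A.toAffine.Point) {n : ℕ} (hn : reductionPointCount A ℓ₀ = p * n)
    (hg : n • red₀ (pointsMap A (v₀.adicCompletion ℚ) (toGeomPoints A g)) ≠ 0)
    (hbudget : ∏ v ∈ T, (Nat.card (nsmulAddMonoidHom p :
        (W.baseChange (v.adicCompletion ℚ)).toAffine.Point →+ _).ker *
          Nat.card (v.adicCompletionIntegers ℚ ⧸
            Ideal.span {(p : v.adicCompletionIntegers ℚ)})) ≤ p) :
    BSDp W p := by
  haveI hV : (A.baseChange (AlgebraicClosure (v₀.adicCompletion ℚ))).IsIntegral w.integer :=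
    ⟨⟨(integralModelInt A).map (algebraMap ℤ ↥w.integer),
      A.baseChange_eq_localIntModel_integer_baseChange⟩⟩
  have hΔ : ¬ (ℓ₀ : ℤ) ∣ minimalDiscriminantInt A :=
    A.not_dvd_minimalDiscriminantInt_of_hasGoodReductionAtPrime' ℓ₀ hAℓ
  exact bsdp_of_bsdp_partner_of_generator_certificate_away W A p hU hU2 hEP hGZK hCT hp2 hr hirr
    hSha hbsdA hrA hirrA hShaA θ hθ S T hTS hS hplaces hkill g
    (not_zsmul_of_residue_certificate A hℓv₀ hw (A.isUnit_Δ_localIntModel hℓv₀ hw hΔ) red₀ hred₀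
      hn g hg) hbudget

end Summit.BirchSwinnertonDyer.Rank1Residual.X11a.SelmerCompanion

end
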